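import Summits.CriticalPhenomena.PercolationContinuityZ3.Theorems.Transplant.FKConnectivityAllQK5CellsReflect
import Summits.CriticalPhenomena.PercolationContinuityZ3.Theorems.Transplant.FKConnectivityAllQK5CellsDecide1
import Summits.CriticalPhenomena.PercolationContinuityZ3.Theorems.Transplant.FKConnectivityAllQK5CellsDecide2
import Summits.CriticalPhenomena.PercolationContinuityZ3.Theorems.Transplant.FKConnectivityAllQK5CellsDecide3
import Summits.CriticalPhenomena.PercolationContinuityZ3.Theorems.Transplant.FKConnectivityAllQK5CellsDecide4
import Summits.CriticalPhenomena.PercolationContinuityZ3.Theorems.Transplant.FKConnectivityAllQK5CellsDecide5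
import Summits.CriticalPhenomena.PercolationContinuityZ3.Theorems.Transplant.FKConnectivityAllQK5CellsDecide6
import Summits.CriticalPhenomena.PercolationContinuityZ3.Theorems.Transplant.FKConnectivityAllQK5CellsDecide7
import Summits.CriticalPhenomena.PercolationContinuityZ3.Theorems.Transplant.FKConnectivityAllQK5CellsDecide8
import Summits.CriticalPhenomena.PercolationContinuityZ3.Theorems.Transplant.FKConnectivityAllQHubCovPinning
import Summits.CriticalPhenomena.PercolationContinuityZ3.Theorems.Transplant.FKConnectivityAllQHubCovEquiv
import Summits.CriticalPhenomena.PercolationContinuityZ3.Theorems.Transplant.FKConnectivityAllQEmbedding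
import HarnessLib

/-!
# Connectivity correlation inequalities for `φ_{w,q}`, every `q > 0` — the `K₅` KERNEL CERTIFICATE, file 4 (assembly):
# **the hub covariance bound, hence negative correlation of adjacent edges, on EVERY weighted graph with at most five vertices,
# `0 < q ≤ 1`**

Helper file (`--supports stmt-CriticalPhenomena-4575`), FK sub-lane `prim-bschramm-fk-3` (gen 10) of the post-continuity programme;
builds on p205010 (kernel theorem, internal audit signed; external expert review pending).  No definitions, no named facts, no sorries;
standard axioms.

THE RESULT.  For the random-cluster measure `φ_{w,q} = rcMeasureW w q ∅` (Grimmett 2006 eq. (1.20)) with `0 < q ≤ 1` on a vertex type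
with at most five elements, every weight vector `w : Sym2 V → [0,1]` and every hub triple `(x; y, z)`:
`HubCovBoundUnder (φ_{w,q}) q x y z`, i.e. `(1 − q)·Cov(1{x↔y}, 1{x↔z}) ≤ φ(x ↮ y, y ↔ z)` (`hubCovBoundUnder_of_card_le_five`); hence
(fk-3 gen 7, `edgeNegCorrAdjOn_of_hubCovBound`) **any two edges with a common vertex are negatively correlated under `φ_{w,q}` on every
weighted graph with `≤ 5` vertices, for every `q ∈ (0,1]`** (`edgeNegCorrAdjOn_of_card_le_five`) — the `n ≤ 5` slice of the conjecture nodes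
`HubCovBoundFKLtOne` / `EdgeNegCorrAdjFKLtOne` (the adjacent-pair part of Grimmett's problem §3.9 / Wagner's Conjecture 5.3 for the
Potts model).  Previously in the tree: `≤ 4` vertices (Sokal's `K₄` computation, fk-1 g5/g6 `edgeNegCorrOn_of_card_le_four`), series–parallel
supports (Wagner's theorem, discharged), wheels (fk-3 g8); fk-3 gen 9 certified `≤ 7` vertices OUTSIDE Lean (DOUBLE-WHEELS.md §10).

THE PROOF (files `…K5CellsDefs` (data), `…HubCovFiberPoly` (fiber polynomials ⇒ bound; loops; listed graphs), `…K5CellsReflect`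
(the fiber polynomials of `K₅ − {01,02}` are `Σ_e cellCoeff e q^e`; Bernstein), `…K5CellsDecide1–8` (the kernel computation: `6561`
fibers, `4^8` table look-ups), and this file):
* `K5.cellOK_all` — the 24 `decide` shards (eight files) cover all masks `< 256`, i.e. all `I ⊆ J ⊆ Fin 8`;
* `K5.hubCovBoundUnder_012` — the bound at `(0; 1, 2)` for EVERY `w` on `Fin 5`: pin `01, 02` (`hubCovBoundUnder_of_pinned`), erase the
  loops (`hubCovBoundUnder_eraseLoops_iff`), and the remaining support lies in `E₈` (`K5.exists_edge_eq`), where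
  `K5.hubCovBoundUnder_012_of_cellOK` applies;
* `hubCovBoundUnder_fin_five` — any triple: degenerate triples by fk-3 g7's degenerate lemmas, distinct triples by TRANSPORT along a
  permutation of `Fin 5` with `σ 0 = x, σ 1 = y, σ 2 = z` (`exists_perm_apply_three`, `hubCovBoundUnder_image_iff`);
* `hubCovBoundUnder_fin_of_le_five`, `hubCovBoundUnder_of_card_le_five` (relabelling; `n ≤ 4` from `…HubCovEquiv` + pinning),
  `edgeNegCorrAdjOn_of_card_le_five`.
[cite: Grimmett2006, §1.4 eq. (1.20) (p. 15); §3.9 eq. (3.94), Conj. (3.96) (pp. 63–66); §4.3] [cite: Wagner2006, Conj. 5.3, Ex. 5.1–5.2 (p. 13)]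
-/

noncomputable section

namespace Summit.CriticalPhenomena.PercolationContinuityZ3.Theorems

namespace FK

open MeasureTheory Literature.Probability.LatticeModels Literature.Probability.Percolation
open scoped Classical

/-! ### All fibers pass -/

namespace K5

/-- **Every fiber of `K₅ − {01, 02}` passes the Bernstein test** (mask form): the 24 `decide` shards. [folklore] -/
theorem cellOK_ofMask (m : ℕ) (hm : m < 256) : ∀ I ∈ (ofMask m).powerset, CellOK I (ofMask m) := by
  intro I hI
  by_cases h0 : m < 61
  · exact cellOK_shard0 m (Finset.mem_Ico.2 ⟨Nat.zero_le _, h0⟩) I hI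
  by_cases h1 : m < 92
  · exact cellOK_shard1 m (Finset.mem_Ico.2 ⟨by omega, h1⟩) I hI
  by_cases h2 : m < 111
  · exact cellOK_shard2 m (Finset.mem_Ico.2 ⟨by omega, h2⟩) I hI
  by_cases h3 : m < 122
  · exact cellOK_shard3 m (Finset.mem_Ico.2 ⟨by omega, h3⟩) I hI
  by_cases h4 : m < 127
  · exact cellOK_shard4 m (Finset.mem_Ico.2 ⟨by omega, h4⟩) I hI
  by_cases h5 : m < 146
  · exact cellOK_shard5 m (Finset.mem_Ico.2 ⟨by omega, h5⟩) I hI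
  by_cases h6 : m < 170
  · exact cellOK_shard6 m (Finset.mem_Ico.2 ⟨by omega, h6⟩) I hI
  by_cases h7 : m < 183
  · exact cellOK_shard7 m (Finset.mem_Ico.2 ⟨by omega, h7⟩) I hI
  by_cases h8 : m < 190
  · exact cellOK_shard8 m (Finset.mem_Ico.2 ⟨by omega, h8⟩) I hI
  by_cases h9 : m < 195
  · exact cellOK_shard9 m (Finset.mem_Ico.2 ⟨by omega, h9⟩) I hI
  by_cases h10 : m < 214
  · exact cellOK_shard10 m (Finset.mem_Ico.2 ⟨by omega, h10⟩) I hI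
  by_cases h11 : m < 221
  · exact cellOK_shard11 m (Finset.mem_Ico.2 ⟨by omega, h11⟩) I hI
  by_cases h12 : m < 223
  · exact cellOK_shard12 m (Finset.mem_Ico.2 ⟨by omega, h12⟩) I hI
  by_cases h13 : m < 230
  · exact cellOK_shard13 m (Finset.mem_Ico.2 ⟨by omega, h13⟩) I hI
  by_cases h14 : m < 237
  · exact cellOK_shard14 m (Finset.mem_Ico.2 ⟨by omega, h14⟩) I hI
  by_cases h15 : m < 239
  · exact cellOK_shard15 m (Finset.mem_Ico.2 ⟨by omega, h15⟩) I hI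
  by_cases h16 : m < 243
  · exact cellOK_shard16 m (Finset.mem_Ico.2 ⟨by omega, h16⟩) I hI
  by_cases h17 : m < 247
  · exact cellOK_shard17 m (Finset.mem_Ico.2 ⟨by omega, h17⟩) I hI
  by_cases h18 : m < 249
  · exact cellOK_shard18 m (Finset.mem_Ico.2 ⟨by omega, h18⟩) I hI
  by_cases h19 : m < 251
  · exact cellOK_shard19 m (Finset.mem_Ico.2 ⟨by omega, h19⟩) I hI
  by_cases h20 : m < 253
  · exact cellOK_shard20 m (Finset.mem_Ico.2 ⟨by omega, h20⟩) I hI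
  by_cases h21 : m < 254
  · exact cellOK_shard21 m (Finset.mem_Ico.2 ⟨by omega, h21⟩) I hI
  by_cases h22 : m < 255
  · exact cellOK_shard22 m (Finset.mem_Ico.2 ⟨by omega, h22⟩) I hI
  exact cellOK_shard23 m (Finset.mem_Ico.2 ⟨by omega, hm⟩) I hI

/-- **Every fiber of `K₅ − {01, 02}` passes the Bernstein test**: `CellOK I J` for all `I ⊆ J ⊆ Fin 8`. [folklore] -/
theorem cellOK_all (I J : Finset (Fin 8)) (hIJ : I ⊆ J) : CellOK I J := by
  have h := cellOK_ofMask (maskOf J) (maskOf_lt J) I (by rw [ofMask_maskOf]; exact Finset.mem_powerset.2 hIJ)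
  rwa [ofMask_maskOf] at h

/-- **The hub covariance bound at `(0; 1, 2)` for EVERY weight vector on `Fin 5`** (`0 < q ≤ 1`): pin the hub pairs, erase the loops,
apply the certificate on `E₈`. [cite: Grimmett2006, §3.9 eq. (3.94) (pp. 63–64); Thm. (3.1)(a) (p. 37)] [cite: Wagner2006, Ex. 5.1–5.2 (p. 13)] -/
theorem hubCovBoundUnder_012 {q : ℝ} (hq0 : 0 < q) (hq1 : q ≤ 1) (w : Sym2 (Fin 5) → unitInterval) :
    HubCovBoundUnder (rcMeasureW w q ∅) q (0 : Fin 5) 1 2 := by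
  refine hubCovBoundUnder_of_pinned hq0 w 0 1 2 ((hubCovBoundUnder_eraseLoops_iff hq0 _ 0 1 2).2 ?_)
  refine hubCovBoundUnder_012_of_cellOK cellOK_all hq0 hq1 _ fun e he => ?_
  -- a pair carrying weight is not a loop, not `01`, not `02`
  have hd : ¬ e.IsDiag := fun h => he (by simp [h])
  have h2 : e ≠ s(0, 2) := by
    rintro rfl
    exact he (by simp [hd])
  have h1 : e ≠ s(0, 1) := by
    rintro rfl
    exact he (by simp [hd, h2])
  exact exists_edge_eq e hd h1 h2

end K5

/-! ### Transport to an arbitrary hub triple -/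

/-- Three distinct points go to three distinct points by a permutation. [folklore] -/
theorem exists_perm_apply_three {α : Type*} [DecidableEq α] {a b c x y z : α} (hab : a ≠ b) (hac : a ≠ c) (hbc : b ≠ c)
    (hxy : x ≠ y) (hxz : x ≠ z) (hyz : y ≠ z) : ∃ σ : Equiv.Perm α, σ a = x ∧ σ b = y ∧ σ c = z := by
  set s₁ : Equiv.Perm α := Equiv.swap a x with hs₁
  have h1 : s₁ a = x := Equiv.swap_apply_left a x
  set s₂ : Equiv.Perm α := s₁ * Equiv.swap b (s₁.symm y) with hs₂
  have h2a : s₂ a = x := by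
    rw [hs₂, Equiv.Perm.mul_apply, Equiv.swap_apply_of_ne_of_ne hab, h1]
    intro h
    apply hxy
    rw [← h1, h, Equiv.apply_symm_apply]
  have h2b : s₂ b = y := by
    rw [hs₂, Equiv.Perm.mul_apply, Equiv.swap_apply_left, Equiv.apply_symm_apply]
  refine ⟨s₂ * Equiv.swap c (s₂.symm z), ?_, ?_, ?_⟩
  · rw [Equiv.Perm.mul_apply, Equiv.swap_apply_of_ne_of_ne hac, h2a]
    intro h
    apply hxz
    rw [← h2a, h, Equiv.apply_symm_apply]
  · rw [Equiv.Perm.mul_apply, Equiv.swap_apply_of_ne_of_ne hbc, h2b]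
    intro h
    apply hyz
    rw [← h2b, h, Equiv.apply_symm_apply]
  · rw [Equiv.Perm.mul_apply, Equiv.swap_apply_left, Equiv.apply_symm_apply]

/-- Every pair is in the range of `Sym2.map σ` for a bijection `σ`. [folklore] -/
theorem mem_range_sym2Map_of_equiv {α β : Type*} (σ : α ≃ β) (e : Sym2 β) : e ∈ Set.range (Sym2.map σ.toEmbedding) := by
  refine ⟨Sym2.map σ.symm e, ?_⟩
  simp [Sym2.map_map]

/-- **The hub covariance bound on every weighted graph with five vertices, `0 < q ≤ 1`, every hub triple.**
[cite: Grimmett2006, §3.9 eq. (3.94), Conj. (3.96) (pp. 63–66); §4.3] [cite: Wagner2006, Conj. 5.3, Ex. 5.1–5.2 (p. 13)] -/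
theorem hubCovBoundUnder_fin_five {q : ℝ} (hq0 : 0 < q) (hq1 : q ≤ 1) (w : Sym2 (Fin 5) → unitInterval) (x y z : Fin 5) :
    HubCovBoundUnder (rcMeasureW w q ∅) q x y z := by
  haveI := isProbabilityMeasure_rcMeasureW w hq0 (∅ : Set (Fin 5))
  by_cases hxy : x = y
  · subst hxy; exact hubCovBoundUnder_of_eq_left _ q x z
  by_cases hxz : x = z
  · subst hxz; exact hubCovBoundUnder_of_eq_right _ q x y
  by_cases hyz : y = z
  · subst hyz; exact hubCovBoundUnder_of_eq _ hq0.le x y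
  obtain ⟨σ, h0, h1, h2⟩ := exists_perm_apply_three (a := (0 : Fin 5)) (b := 1) (c := 2) (by decide) (by decide) (by decide)
    hxy hxz hyz
  have hw : ∀ e, e ∉ Set.range (Sym2.map σ.toEmbedding) → w e = 0 :=
    fun e he => absurd (mem_range_sym2Map_of_equiv σ e) he
  have key := (hubCovBoundUnder_image_iff σ.toEmbedding w hw hq0 (0 : Fin 5) 1 2).2
    (K5.hubCovBoundUnder_012 hq0 hq1 _)
  rw [Equiv.coe_toEmbedding, h0, h1, h2] at key
  exact key

/-- **The hub covariance bound on `Fin n`, `n ≤ 5`** (`0 < q ≤ 1`; `n ≤ 4` from `…HubCovEquiv` after pinning, `n = 5` above).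
[cite: Grimmett2006, §3.9 eq. (3.94) (pp. 63–66)] [cite: Wagner2006, Conj. 5.3, Ex. 5.1–5.2, §5.3 (p. 13)] -/
theorem hubCovBoundUnder_fin_of_le_five {n : ℕ} (hn : n ≤ 5) {q : ℝ} (hq0 : 0 < q) (hq1 : q ≤ 1)
    (w : Sym2 (Fin n) → unitInterval) (x y z : Fin n) : HubCovBoundUnder (rcMeasureW w q ∅) q x y z := by
  rcases Nat.lt_or_ge n 5 with hlt | hge
  · rcases hq1.lt_or_eq with hq1' | rfl
    swap
    · exact hubCovBoundUnder_of_q_one _ x y z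
    refine hubCovBoundUnder_of_pinned hq0 w x y z ?_
    refine hubCovBoundUnder_of_card_le_four (by rw [Fintype.card_fin]; omega) hq0 hq1' _ x y z ?_ ?_
    · simp [Function.update_apply]
    · simp
  · obtain rfl : n = 5 := le_antisymm hn hge
    exact hubCovBoundUnder_fin_five hq0 hq1 w x y z

/-- **The hub covariance bound on every finite vertex type with at most five elements** (`0 < q ≤ 1`, every weight vector, every
triple): `(1 − q)·Cov_φ(1{x↔y}, 1{x↔z}) ≤ φ(x ↮ y, y ↔ z)` — the `card V ≤ 5` slice of the conjecture node `HubCovBoundFKLtOne`.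
[cite: Grimmett2006, §3.9 eq. (3.94), Conj. (3.96) (pp. 63–66); §4.3] [cite: Wagner2006, Conj. 5.3, Ex. 5.1–5.2 (p. 13)] -/
theorem hubCovBoundUnder_of_card_le_five {V : Type*} [Fintype V] (hV : Fintype.card V ≤ 5) {q : ℝ} (hq0 : 0 < q) (hq1 : q ≤ 1)
    (w : Sym2 V → unitInterval) (x y z : V) : HubCovBoundUnder (rcMeasureW w q ∅) q x y z := by
  set σ : Fin (Fintype.card V) ≃ V := (Fintype.equivFin V).symm with hσ
  have hw : ∀ e, e ∉ Set.range (Sym2.map σ.toEmbedding) → w e = 0 :=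
    fun e he => absurd (mem_range_sym2Map_of_equiv σ e) he
  have key := (hubCovBoundUnder_image_iff σ.toEmbedding w hw hq0 (σ.symm x) (σ.symm y) (σ.symm z)).2
    (hubCovBoundUnder_fin_of_le_five hV hq0 hq1 _ _ _ _)
  rw [Equiv.coe_toEmbedding, Equiv.apply_symm_apply, Equiv.apply_symm_apply, Equiv.apply_symm_apply] at key
  exact key

/-! ### Negative correlation of adjacent edges -/

/-- **Adjacent edges are negatively correlated under `φ_{w,q}` on every weighted graph with five vertices, `0 < q ≤ 1`.**
[cite: Grimmett2006, §3.9 eq. (3.94) (p. 63)] [cite: Wagner2006, Conj. 5.3, Ex. 5.1–5.2 (p. 13)] -/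
theorem edgeNegCorrAdjOn_fin_five {q : ℝ} (hq0 : 0 < q) (hq1 : q ≤ 1) : EdgeNegCorrAdjOn (Fin 5) q :=
  edgeNegCorrAdjOn_of_hubCovBound hq0 hq1 fun w x y z => hubCovBoundUnder_fin_five hq0 hq1 w x y z

/-- **Adjacent edges are negatively correlated under `φ_{w,q}` on every weighted graph with at most five vertices, `0 < q ≤ 1`**:
for every finite vertex type `V` with `card V ≤ 5`, every weight vector `w : Sym2 V → [0,1]`, and all non-loop pairs `e ≠ f` sharing a
vertex, `φ_{w,q}(e, f open) ≤ φ_{w,q}(e open)·φ_{w,q}(f open)` — the `card V ≤ 5` slice of the conjecture node `EdgeNegCorrAdjFKLtOne`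
(Grimmett §3.9 / Wagner Conj. 5.3, adjacent pairs), extending `edgeNegCorrAdjOn_of_card_le_four`.
[cite: Grimmett2006, §3.9 eq. (3.94), Conj. (3.96) (pp. 63–66)] [cite: Wagner2006, Conj. 5.3, Ex. 5.1–5.2 (p. 13)] -/
theorem edgeNegCorrAdjOn_of_card_le_five {V : Type*} [Fintype V] (hV : Fintype.card V ≤ 5) {q : ℝ} (hq0 : 0 < q) (hq1 : q ≤ 1) :
    EdgeNegCorrAdjOn V q :=
  edgeNegCorrAdjOn_of_hubCovBound hq0 hq1 fun w x y z => hubCovBoundUnder_of_card_le_five hV hq0 hq1 w x y z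

end FK

end Summit.CriticalPhenomena.PercolationContinuityZ3.Theorems

end
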